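import Mathlib
import HarnessLib

/-!
# Norms on Taylor polynomials of field functionals relative to a gauge
# (Adams–Buchholz–Kotecký–Müller, App. A = Ch. 13; Brydges–Slade I, §3)

The multiscale analysis of gradient models (Adams–Kotecký–Müller, Adams–Buchholz–Kotecký–Müller
[ABKM19]) measures a smooth functional `F` of the field `φ ∈ 𝒳` by a norm of its Taylor polynomial
of order `r₀` at `φ`,
`‖F‖_{T_φ} = Σ_{s ≤ r₀} (1/s!) ‖D^s F(φ)‖'`,
where `‖·‖'` is the norm on `s`-linear forms DUAL to a norm `|·|` on the space of fields ("A norm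
on `𝒳` induces in a natural way norms on the tensor products … and by duality on polynomials",
[ABKM19] Ch. 13).  The field norm is a weighted
maximum of finitely many linear functionals — lattice derivatives `𝔥⁻¹ R^{|α|} ∇^α φ(x)`, `x` near a
polymer, `1 ≤ |α| ≤ p_Φ` ([ABKM19] (6.40)–(6.41), App. A.5 "Main example") — so that `|·|` is only a
SEMInorm on all fields (constants, and fields far from the polymer, have gauge zero) and becomes a
norm on the quotient `𝒳/N`, `N = {ξ : ℓ(ξ) = 0 ∀ ℓ}` ([ABKM19] App. A.4: "the linear functionals
induce a norm on `𝒳 := ℝ^E/N_Φ`").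

## Design (this file; generic, model-free)

We encode the family of functionals as ONE linear map `T : E →ₗ[ℝ] V` into a finite-dimensional
normed space `V` (in the application `V = (Φ → ℝ)` with the sup norm and `T φ = (ℓ(φ))_{ℓ ∈ Φ}`, so
that the gauge is `|ξ| = ‖T ξ‖ = max_ℓ |ℓ(ξ)|`).  The quotient `E/ker T` with the gauge norm is
ISOMETRIC to the subspace `range T ⊆ V` with the norm of `V`; we therefore realise it as the
Mathlib normed space `LinearMap.range T` and transport functionals along a fixed linear section
`gaugeSection T : range T →ₗ[ℝ] E` of `T` (`gaugeLift T F = F ∘ gaugeSection T`).  For a functional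
that is LOCAL with respect to the gauge (`IsGaugeLocal T F`: `F φ` depends on `T φ` only — [ABKM19]'s
"local and shift invariant" functionals, for which alone their norm is finite, remark after (6.46))
the lift does not depend on the section and `F = gaugeLift T F ∘ T`.  The Taylor norm is then

`tayNorm T r₀ F φ = Σ_{s=0}^{r₀} (s!)⁻¹ ‖D^s (gaugeLift T F) (T φ)‖`

with Mathlib's operator norm of the `s`-th Fréchet derivative, a continuous `s`-linear map on
`range T`.  This is [ABKM19] Definition 13.7 with the tensor norm `ι = ∧` (projective norm on
`𝒳^{⊗s}`; its dual on `s`-linear forms is "the usual norm of multilinear maps", (13.35)); [ABKM19]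
prove the product/polynomial/two-norm properties for both `ι ∈ {∨, ∧}` (Lemma 13.4 – Prop. 13.11)
and use `∨` in the body ("This is not crucial", Ch. 6.4).  Values of `F` are taken in a real
normed algebra `𝔸` (`ℝ` in the source; `ℂ` for complex perturbations).

## Contents (everything is proved; no named fact)
* `gaugeSection`, `gaugeLift`, `IsGaugeLocal` (closed under `+`, `•`, `*`, constants, post-composition),
  `gaugeLift_rangeRestrict` (`F = F̄ ∘ T` for local `F`), `contDiff_gaugeLift`;
* `tayNorm` and: `tayNorm_nonneg`, `norm_apply_le_tayNorm` (`‖F(φ)‖ ≤ ‖F‖_{T_φ}`, [ABKM19] (8.2)),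
  `tayNorm_add_le`, `tayNorm_smul`, `tayNorm_const`;
* **`tayNorm_mul_le`** — the PRODUCT PROPERTY `‖FG‖_{T_φ} ≤ ‖F‖_{T_φ} ‖G‖_{T_φ}`
  ([ABKM19] Proposition 13.9 = [BS15I] Proposition 3.7), from Mathlib's Leibniz bound
  `norm_iteratedFDeriv_mul_le` and the inequality `Σ_{i+j ≤ r₀} a_i b_j/(i!j!) ≤ (Σ a_i/i!)(Σ b_j/j!)`;
  `tayNorm_prod_le` (finite products, commutative `𝔸`);
* the sequel `TaylorPolynomialNormsPullback.lean` has the working estimate for functionals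
  `F = f ∘ P` factoring through a `T`-bounded linear map, the duality bound for `D^sF(φ)(ξ_1,…,ξ_s)`
  and the monotonicity of `‖·‖_{T_φ}` in the gauge.

What is NOT here: the lattice gauges (weights `w_k(α)`, small-set neighbourhoods), the weights
`w_k^X`, `W_k^X` and the weak/strong norms ([ABKM19] (6.47)–(6.50)), Propositions 13.10–13.11.
-- TODO(general form): the `ι = ∨` (injective-on-tensors) variant of [ABKM19] Ch. 6.4.

References: S. Adams, S. Buchholz, R. Kotecký, S. Müller, arXiv:1910.13564, Ch. 6.4 and App. A
(= Ch. 13) [AdamsBuchholzKoteckyMuller2019]; D. Brydges, G. Slade, J. Stat. Phys. 159 (2015), §3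
[BrydgesSlade2015RGI].
-/

noncomputable section

namespace Literature.MathematicalPhysics.StatisticalMechanics.GradientRG

open Finset

section Gauge

variable {E V : Type*} [NormedAddCommGroup E] [NormedSpace ℝ E]
  [NormedAddCommGroup V] [NormedSpace ℝ V] {𝔸 : Type*}

/-! ## The gauge space `range T`, a section of `T`, and the lift of a functional -/

/-- A fixed linear SECTION of the gauge map: `gaugeSection T : range T →ₗ[ℝ] E` with
`T (gaugeSection T w) = w` (any right inverse of the surjection `E → range T`; obtained by choice).
[cite: AdamsBuchholzKoteckyMuller2019, App. A.4 (the quotient 𝒳 = ℝ^E/N_Φ)] -/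
def gaugeSection (T : E →ₗ[ℝ] V) : LinearMap.range T →ₗ[ℝ] E :=
  (T.rangeRestrict.exists_rightInverse_of_surjective T.range_rangeRestrict).choose

/-- The defining property of the section: `T ∘ gaugeSection T = id` on `range T`.
[cite: AdamsBuchholzKoteckyMuller2019, App. A.4 (the quotient 𝒳 = ℝ^E/N_Φ)] -/
theorem rangeRestrict_gaugeSection (T : E →ₗ[ℝ] V) (w : LinearMap.range T) :
    T.rangeRestrict (gaugeSection T w) = w := by
  have h := (T.rangeRestrict.exists_rightInverse_of_surjective T.range_rangeRestrict).choose_spec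
  exact LinearMap.congr_fun h w

/-- The section, read in `V`: `T (gaugeSection T w) = w`.
[cite: AdamsBuchholzKoteckyMuller2019, App. A.4 (the quotient 𝒳 = ℝ^E/N_Φ)] -/
theorem apply_gaugeSection (T : E →ₗ[ℝ] V) (w : LinearMap.range T) :
    T (gaugeSection T w) = (w : V) := by
  have h := rangeRestrict_gaugeSection T w
  exact congrArg Subtype.val h

/-- The norm of `T.rangeRestrict ξ` in the subspace `range T` is the gauge `‖T ξ‖` (the quotient
`𝒳/N_Φ` with its induced norm). [cite: AdamsBuchholzKoteckyMuller2019, App. A.4 (the quotient 𝒳 = ℝ^E/N_Φ and its norm)] -/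
theorem norm_rangeRestrict (T : E →ₗ[ℝ] V) (ξ : E) : ‖T.rangeRestrict ξ‖ = ‖T ξ‖ := rfl

/-- **The lift of a functional to the gauge space**: `gaugeLift T F = F ∘ gaugeSection T`, a
function on the normed space `range T ≅ 𝒳/N_Φ`. [cite: AdamsBuchholzKoteckyMuller2019, App. A.4 (the quotient 𝒳 = ℝ^E/N_Φ)] -/
def gaugeLift (T : E →ₗ[ℝ] V) (F : E → 𝔸) : LinearMap.range T → 𝔸 := fun w => F (gaugeSection T w)

/-- Unfolding `gaugeLift`. [cite: AdamsBuchholzKoteckyMuller2019, App. A.4 (the quotient 𝒳 = ℝ^E/N_Φ)] -/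
theorem gaugeLift_apply (T : E →ₗ[ℝ] V) (F : E → 𝔸) (w : LinearMap.range T) :
    gaugeLift T F w = F (gaugeSection T w) := rfl

/-- **Locality with respect to the gauge**: `F φ` depends on `φ` only through `T φ` — the abstract
form of "local and shift invariant" ([ABKM19]: the `T_φ` norm "is finite if and only if
`Tay_φ F(·+ψ) = Tay_φ F` for all `ψ` with `|ψ|_{j,X} = 0`", remark after (6.46)).
[cite: AdamsBuchholzKoteckyMuller2019, Ch. 6.4 (remark after (6.46))] -/
def IsGaugeLocal (T : E →ₗ[ℝ] V) (F : E → 𝔸) : Prop := ∀ φ ψ : E, T φ = T ψ → F φ = F ψ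

/-- For a local functional the lift recovers `F`: `gaugeLift T F (T φ) = F φ`.
[cite: AdamsBuchholzKoteckyMuller2019, Ch. 6.4 (remark after (6.46))] -/
theorem gaugeLift_rangeRestrict {T : E →ₗ[ℝ] V} {F : E → 𝔸} (hF : IsGaugeLocal T F) (φ : E) :
    gaugeLift T F (T.rangeRestrict φ) = F φ := by
  unfold gaugeLift
  apply hF
  rw [apply_gaugeSection]
  rfl

namespace IsGaugeLocal

variable {T : E →ₗ[ℝ] V} {F G : E → 𝔸}

/-- Constants are local. [cite: AdamsBuchholzKoteckyMuller2019, Ch. 6.2 (local, shift-invariant functionals M(𝒫_k, 𝒳))] -/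
theorem const (T : E →ₗ[ℝ] V) (c : 𝔸) : IsGaugeLocal T (fun _ : E => c) := fun _ _ _ => rfl

/-- Sums of local functionals are local. [cite: AdamsBuchholzKoteckyMuller2019, Ch. 6.2 (local, shift-invariant functionals M(𝒫_k, 𝒳))] -/
theorem add [Add 𝔸] (hF : IsGaugeLocal T F) (hG : IsGaugeLocal T G) : IsGaugeLocal T (F + G) :=
  fun φ ψ h => by simp only [Pi.add_apply, hF φ ψ h, hG φ ψ h]

/-- Products of local functionals are local. [cite: AdamsBuchholzKoteckyMuller2019, Ch. 6.2 (local, shift-invariant functionals M(𝒫_k, 𝒳))] -/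
theorem mul [Mul 𝔸] (hF : IsGaugeLocal T F) (hG : IsGaugeLocal T G) : IsGaugeLocal T (F * G) :=
  fun φ ψ h => by simp only [Pi.mul_apply, hF φ ψ h, hG φ ψ h]

/-- Scalar multiples of local functionals are local. [cite: AdamsBuchholzKoteckyMuller2019, Ch. 6.2 (local, shift-invariant functionals M(𝒫_k, 𝒳))] -/
theorem smul [SMul ℝ 𝔸] (hF : IsGaugeLocal T F) (a : ℝ) : IsGaugeLocal T (a • F) :=
  fun φ ψ h => by simp only [Pi.smul_apply, hF φ ψ h]

/-- Post-composition preserves locality. [cite: AdamsBuchholzKoteckyMuller2019, Ch. 6.2 (local, shift-invariant functionals M(𝒫_k, 𝒳))] -/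
theorem comp_left {𝔹 : Type*} (hF : IsGaugeLocal T F) (g : 𝔸 → 𝔹) : IsGaugeLocal T (g ∘ F) :=
  fun φ ψ h => by simp only [Function.comp_apply, hF φ ψ h]

/-- Finite products of local functionals are local (polymer activities `∏_{x∈X} 𝒦(∇φ(x))`).
[cite: AdamsBuchholzKoteckyMuller2019, Ch. 6.2 (local, shift-invariant functionals M(𝒫_k, 𝒳))] -/
theorem prod {ι : Type*} {𝔸' : Type*} [CommMonoid 𝔸'] {T : E →ₗ[ℝ] V} (s : Finset ι)
    {F : ι → E → 𝔸'} (hF : ∀ i ∈ s, IsGaugeLocal T (F i)) :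
    IsGaugeLocal T (fun φ => ∏ i ∈ s, F i φ) :=
  fun φ ψ h => Finset.prod_congr rfl fun i hi => hF i hi φ ψ h

/-- A functional that factors through a `T`-bounded linear map is local.
[cite: AdamsBuchholzKoteckyMuller2019, Ch. 6.2 (local, shift-invariant functionals M(𝒫_k, 𝒳))] -/
theorem of_factor {U : Type*} [NormedAddCommGroup U] [NormedSpace ℝ U] {T : E →ₗ[ℝ] V}
    (P : E →ₗ[ℝ] U) {c : ℝ} (hP : ∀ ξ, ‖P ξ‖ ≤ c * ‖T ξ‖) (f : U → 𝔸) :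
    IsGaugeLocal T (fun φ => f (P φ)) := by
  intro φ ψ h
  have h0 : ‖P (φ - ψ)‖ ≤ c * ‖T (φ - ψ)‖ := hP _
  rw [map_sub T, h, sub_self, norm_zero, mul_zero] at h0
  have : P φ = P ψ := by
    rw [← sub_eq_zero, ← map_sub]
    exact norm_le_zero_iff.1 h0
  simp only [this]

end IsGaugeLocal

/-- The lift is multiplicative. [cite: AdamsBuchholzKoteckyMuller2019, App. A.4 (the quotient 𝒳 = ℝ^E/N_Φ)] -/
theorem gaugeLift_mul [Mul 𝔸] (T : E →ₗ[ℝ] V) (F G : E → 𝔸) :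
    gaugeLift T (F * G) = gaugeLift T F * gaugeLift T G := rfl

/-- The lift is additive. [cite: AdamsBuchholzKoteckyMuller2019, App. A.4 (the quotient 𝒳 = ℝ^E/N_Φ)] -/
theorem gaugeLift_add [Add 𝔸] (T : E →ₗ[ℝ] V) (F G : E → 𝔸) :
    gaugeLift T (F + G) = gaugeLift T F + gaugeLift T G := rfl

/-- The lift commutes with scalars. [cite: AdamsBuchholzKoteckyMuller2019, App. A.4 (the quotient 𝒳 = ℝ^E/N_Φ)] -/
theorem gaugeLift_smul [SMul ℝ 𝔸] (T : E →ₗ[ℝ] V) (a : ℝ) (F : E → 𝔸) :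
    gaugeLift T (a • F) = a • gaugeLift T F := rfl

/-- The lift of a constant is the constant. [cite: AdamsBuchholzKoteckyMuller2019, App. A.4 (the quotient 𝒳 = ℝ^E/N_Φ)] -/
theorem gaugeLift_const (T : E →ₗ[ℝ] V) (c : 𝔸) :
    gaugeLift T (fun _ : E => c) = fun _ => c := rfl

end Gauge

section Analytic

variable {E V : Type*} [NormedAddCommGroup E] [NormedSpace ℝ E] [FiniteDimensional ℝ E]
  [NormedAddCommGroup V] [NormedSpace ℝ V]
  {𝔸 : Type*} [NormedRing 𝔸] [NormedAlgebra ℝ 𝔸]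

/-! ## Continuity of the section (finite dimension) and smoothness of the lift -/

/-- The section as a continuous linear map (its domain `range T` is finite-dimensional, `E` being
so). [cite: AdamsBuchholzKoteckyMuller2019, App. A.4 (the quotient 𝒳 = ℝ^E/N_Φ)] -/
def gaugeSectionCLM (T : E →ₗ[ℝ] V) : LinearMap.range T →L[ℝ] E :=
  LinearMap.toContinuousLinearMap (gaugeSection T)

/-- `gaugeSectionCLM` is `gaugeSection` as a function. [cite: AdamsBuchholzKoteckyMuller2019, App. A.4 (the quotient 𝒳 = ℝ^E/N_Φ)] -/
@[simp] theorem gaugeSectionCLM_apply (T : E →ₗ[ℝ] V) (w : LinearMap.range T) :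
    gaugeSectionCLM T w = gaugeSection T w := rfl

/-- The gauge map with values in its range, as a continuous linear map. [cite: AdamsBuchholzKoteckyMuller2019, App. A.4 (the quotient 𝒳 = ℝ^E/N_Φ)] -/
def gaugeRestrictCLM (T : E →ₗ[ℝ] V) : E →L[ℝ] LinearMap.range T :=
  LinearMap.toContinuousLinearMap T.rangeRestrict

/-- `gaugeRestrictCLM` is `T.rangeRestrict` as a function. [cite: AdamsBuchholzKoteckyMuller2019, App. A.4 (the quotient 𝒳 = ℝ^E/N_Φ)] -/
@[simp] theorem gaugeRestrictCLM_apply (T : E →ₗ[ℝ] V) (φ : E) :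
    gaugeRestrictCLM T φ = T.rangeRestrict φ := rfl

omit [NormedRing 𝔸] [NormedAlgebra ℝ 𝔸] in
/-- A local functional factors through the gauge map: `F = gaugeLift T F ∘ T`.
[cite: AdamsBuchholzKoteckyMuller2019, Ch. 6.4 (remark after (6.46))] -/
theorem eq_gaugeLift_comp {T : E →ₗ[ℝ] V} {F : E → 𝔸} (hF : IsGaugeLocal T F) :
    F = gaugeLift T F ∘ gaugeRestrictCLM T := by
  funext φ
  simp only [Function.comp_apply, gaugeRestrictCLM_apply, gaugeLift_rangeRestrict hF]

/-- The lift of a `C^n` functional is `C^n` (composition with a continuous linear map).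
[cite: AdamsBuchholzKoteckyMuller2019, Definition 13.7 (F ∈ C^{r₀}(U))] -/
theorem contDiff_gaugeLift (T : E →ₗ[ℝ] V) {F : E → 𝔸} {n : WithTop ℕ∞} (hF : ContDiff ℝ n F) :
    ContDiff ℝ n (gaugeLift T F) :=
  hF.comp (gaugeSectionCLM T).contDiff

/-! ## The Taylor norm `‖F‖_{T_φ}` -/

/-- **The Taylor norm of order `r₀` at `φ` relative to the gauge `T`**:
`‖F‖_{T_φ} = Σ_{s=0}^{r₀} (s!)⁻¹ ‖D^s F̄ (Tφ)‖`, `F̄ = gaugeLift T F`, with the operator norm of the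
`s`-linear form `D^s F̄(Tφ)` on `range T` ([ABKM19] Definition 13.7 and (6.46), tensor norm `ι = ∧`:
"`‖L‖'_∧ = sup{⟨L, ξ_1 ⊗ … ⊗ ξ_r⟩ : ‖ξ_i‖ ≤ 1}` … the usual norm of multilinear maps", (13.35)).
[cite: AdamsBuchholzKoteckyMuller2019, Definition 13.7 and App. A.6 (13.35)] -/
def tayNorm (T : E →ₗ[ℝ] V) (r₀ : ℕ) (F : E → 𝔸) (φ : E) : ℝ :=
  ∑ s ∈ Finset.range (r₀ + 1),
    ((s.factorial : ℝ)⁻¹) * ‖iteratedFDeriv ℝ s (gaugeLift T F) (T.rangeRestrict φ)‖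

omit [FiniteDimensional ℝ E] in
/-- `0 ≤ ‖F‖_{T_φ}`. [cite: AdamsBuchholzKoteckyMuller2019, Definition 13.7] -/
theorem tayNorm_nonneg (T : E →ₗ[ℝ] V) (r₀ : ℕ) (F : E → 𝔸) (φ : E) : 0 ≤ tayNorm T r₀ F φ :=
  Finset.sum_nonneg fun _ _ => mul_nonneg (inv_nonneg.2 (Nat.cast_nonneg _)) (norm_nonneg _)

omit [FiniteDimensional ℝ E] in
/-- **`‖F(φ)‖ ≤ ‖F‖_{T_φ}`** for a local functional (the degree-zero term; [ABKM19] (8.2):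
"`|F(φ)| ≤ |F|_{T_φ}`"). [cite: AdamsBuchholzKoteckyMuller2019, Ch. 8.1 (8.2)] -/
theorem norm_apply_le_tayNorm {T : E →ₗ[ℝ] V} (r₀ : ℕ) {F : E → 𝔸} (hF : IsGaugeLocal T F)
    (φ : E) : ‖F φ‖ ≤ tayNorm T r₀ F φ := by
  unfold tayNorm
  rw [Finset.sum_range_succ']
  have h0 : ((Nat.factorial 0 : ℝ)⁻¹) *
      ‖iteratedFDeriv ℝ 0 (gaugeLift T F) (T.rangeRestrict φ)‖ = ‖F φ‖ := by
    rw [norm_iteratedFDeriv_zero, gaugeLift_rangeRestrict hF, Nat.factorial_zero, Nat.cast_one,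
      inv_one, one_mul]
  rw [h0]
  exact le_add_of_nonneg_left (Finset.sum_nonneg fun _ _ =>
    mul_nonneg (inv_nonneg.2 (Nat.cast_nonneg _)) (norm_nonneg _))

omit [FiniteDimensional ℝ E] in
/-- The Taylor norm of a constant functional is the norm of the constant.
[cite: AdamsBuchholzKoteckyMuller2019, Definition 13.7] -/
theorem tayNorm_const (T : E →ₗ[ℝ] V) (r₀ : ℕ) (c : 𝔸) (φ : E) :
    tayNorm T r₀ (fun _ : E => c) φ = ‖c‖ := by
  unfold tayNorm
  rw [Finset.sum_range_succ', gaugeLift_const, norm_iteratedFDeriv_zero, Nat.factorial_zero,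
    Nat.cast_one, inv_one, one_mul]
  rw [Finset.sum_eq_zero fun s _ => by
    rw [iteratedFDeriv_succ_const, Pi.zero_apply, norm_zero, mul_zero]]
  rw [zero_add]

/-- Homogeneity: `‖a • F‖_{T_φ} = |a| ‖F‖_{T_φ}` for `C^{r₀}` functionals (the norm is a seminorm).
[cite: AdamsBuchholzKoteckyMuller2019, Definition 13.7] -/
theorem tayNorm_smul (T : E →ₗ[ℝ] V) {r₀ : ℕ} {F : E → 𝔸} (hF : ContDiff ℝ r₀ F) (a : ℝ) (φ : E) :
    tayNorm T r₀ (a • F) φ = |a| * tayNorm T r₀ F φ := by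
  unfold tayNorm
  rw [Finset.mul_sum]
  refine Finset.sum_congr rfl fun s hs => ?_
  have hs' : (s : WithTop ℕ∞) ≤ r₀ := by
    exact_mod_cast Nat.lt_succ_iff.1 (Finset.mem_range.1 hs)
  rw [gaugeLift_smul, iteratedFDeriv_const_smul_apply
    (((contDiff_gaugeLift T hF).of_le hs').contDiffAt), norm_smul, Real.norm_eq_abs]
  ring

/-- **Subadditivity**: `‖F + G‖_{T_φ} ≤ ‖F‖_{T_φ} + ‖G‖_{T_φ}` for `C^{r₀}` functionals.
[cite: AdamsBuchholzKoteckyMuller2019, Definition 13.7] -/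
theorem tayNorm_add_le (T : E →ₗ[ℝ] V) {r₀ : ℕ} {F G : E → 𝔸} (hF : ContDiff ℝ r₀ F)
    (hG : ContDiff ℝ r₀ G) (φ : E) :
    tayNorm T r₀ (F + G) φ ≤ tayNorm T r₀ F φ + tayNorm T r₀ G φ := by
  unfold tayNorm
  rw [← Finset.sum_add_distrib]
  refine Finset.sum_le_sum fun s hs => ?_
  have hs' : (s : WithTop ℕ∞) ≤ r₀ := by
    exact_mod_cast Nat.lt_succ_iff.1 (Finset.mem_range.1 hs)
  rw [← mul_add, gaugeLift_add, iteratedFDeriv_add_apply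
    (((contDiff_gaugeLift T hF).of_le hs').contDiffAt)
    (((contDiff_gaugeLift T hG).of_le hs').contDiffAt)]
  exact mul_le_mul_of_nonneg_left (norm_add_le _ _) (inv_nonneg.2 (Nat.cast_nonneg _))

/-! ## The product property -/

/-- The combinatorial heart of the product property: for non-negative sequences,
`Σ_{s ≤ r} (s!)⁻¹ Σ_{i ≤ s} C(s,i) a_i b_{s-i} ≤ (Σ_{i ≤ r} a_i/i!) (Σ_{j ≤ r} b_j/j!)`
(the left side is the sum of `a_i b_j/(i! j!)` over `i + j ≤ r`, a sub-sum of the right side —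
"the Taylor polynomial of the product is the product of the Taylor polynomials, truncated at
degree `r₀`"). [cite: AdamsBuchholzKoteckyMuller2019, Proposition 13.9 (proof)] -/
theorem sum_inv_factorial_choose_le {a b : ℕ → ℝ} (ha : ∀ i, 0 ≤ a i) (hb : ∀ j, 0 ≤ b j)
    (r : ℕ) :
    ∑ s ∈ Finset.range (r + 1), ((s.factorial : ℝ)⁻¹) *
        ∑ i ∈ Finset.range (s + 1), (s.choose i : ℝ) * a i * b (s - i) ≤
      (∑ i ∈ Finset.range (r + 1), ((i.factorial : ℝ)⁻¹) * a i) *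
        ∑ j ∈ Finset.range (r + 1), ((j.factorial : ℝ)⁻¹) * b j := by
  -- rewrite each term as `(a_i/i!) (b_{s-i}/(s-i)!)`
  have hterm : ∀ s ∈ Finset.range (r + 1), ((s.factorial : ℝ)⁻¹) *
      ∑ i ∈ Finset.range (s + 1), (s.choose i : ℝ) * a i * b (s - i) =
      ∑ i ∈ Finset.range (s + 1), (((i.factorial : ℝ)⁻¹) * a i) *
        ((((s - i).factorial : ℝ)⁻¹) * b (s - i)) := by
    intro s _
    rw [Finset.mul_sum]
    refine Finset.sum_congr rfl fun i hi => ?_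
    have hi' : i ≤ s := Nat.lt_succ_iff.1 (Finset.mem_range.1 hi)
    have hfac : (s.choose i : ℝ) * (i.factorial : ℝ) * ((s - i).factorial : ℝ) = s.factorial := by
      exact_mod_cast Nat.choose_mul_factorial_mul_factorial hi'
    have h1 : (i.factorial : ℝ) ≠ 0 := by positivity
    have h2 : ((s - i).factorial : ℝ) ≠ 0 := by positivity
    have h3 : (s.factorial : ℝ) ≠ 0 := by positivity
    have h4 : (s.choose i : ℝ) ≠ 0 := by
      exact_mod_cast (Nat.choose_pos hi').ne'
    rw [← hfac]
    field_simp
  rw [Finset.sum_congr rfl hterm]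
  -- swap the order of summation: `Σ_{s ≤ r} Σ_{i ≤ s} = Σ_{i ≤ r} Σ_{s ∈ [i, r]}`
  rw [Finset.sum_comm' (t' := Finset.range (r + 1)) (s' := fun i => Finset.Ico i (r + 1))
    (h := fun s i => by
      simp only [Finset.mem_range, Finset.mem_Ico]
      omega)]
  rw [Finset.sum_mul]
  refine Finset.sum_le_sum fun i hi => ?_
  rw [← Finset.mul_sum, Finset.sum_Ico_eq_sum_range]
  refine mul_le_mul_of_nonneg_left ?_ (mul_nonneg (inv_nonneg.2 (Nat.cast_nonneg _)) (ha i))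
  have hsub : Finset.range (r + 1 - i) ⊆ Finset.range (r + 1) :=
    Finset.range_mono (Nat.sub_le _ _)
  calc ∑ k ∈ Finset.range (r + 1 - i), (((i + k - i).factorial : ℝ)⁻¹) * b (i + k - i)
      = ∑ k ∈ Finset.range (r + 1 - i), (((k.factorial : ℝ)⁻¹) * b k) :=
        Finset.sum_congr rfl fun k _ => by rw [Nat.add_sub_cancel_left]
    _ ≤ ∑ j ∈ Finset.range (r + 1), ((j.factorial : ℝ)⁻¹) * b j :=
        Finset.sum_le_sum_of_subset_of_nonneg hsub fun j _ _ =>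
          mul_nonneg (inv_nonneg.2 (Nat.cast_nonneg _)) (hb j)

/-- **Product property of the Taylor norm** ([ABKM19] Proposition 13.9 = [BS15I] Proposition 3.7:
"`‖FG‖_{T_φ} ≤ ‖F‖_{T_φ} ‖G‖_{T_φ}`"), for `C^{r₀}` functionals with values in a real normed
algebra.  Proof: Leibniz bound for `D^s(F̄ Ḡ)` (Mathlib `norm_iteratedFDeriv_mul_le`) and
`sum_inv_factorial_choose_le`. [cite: AdamsBuchholzKoteckyMuller2019, Proposition 13.9] -/
theorem tayNorm_mul_le (T : E →ₗ[ℝ] V) {r₀ : ℕ} {F G : E → 𝔸} (hF : ContDiff ℝ r₀ F)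
    (hG : ContDiff ℝ r₀ G) (φ : E) :
    tayNorm T r₀ (F * G) φ ≤ tayNorm T r₀ F φ * tayNorm T r₀ G φ := by
  have hF' := contDiff_gaugeLift T hF
  have hG' := contDiff_gaugeLift T hG
  set w := T.rangeRestrict φ
  set a : ℕ → ℝ := fun i => ‖iteratedFDeriv ℝ i (gaugeLift T F) w‖ with ha_def
  set b : ℕ → ℝ := fun j => ‖iteratedFDeriv ℝ j (gaugeLift T G) w‖ with hb_def
  have ha : ∀ i, 0 ≤ a i := fun i => norm_nonneg _
  have hb : ∀ j, 0 ≤ b j := fun j => norm_nonneg _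
  calc tayNorm T r₀ (F * G) φ
      ≤ ∑ s ∈ Finset.range (r₀ + 1), ((s.factorial : ℝ)⁻¹) *
          ∑ i ∈ Finset.range (s + 1), (s.choose i : ℝ) * a i * b (s - i) := by
        unfold tayNorm
        refine Finset.sum_le_sum fun s hs => ?_
        have hs' : (s : WithTop ℕ∞) ≤ r₀ := by
          exact_mod_cast Nat.lt_succ_iff.1 (Finset.mem_range.1 hs)
        refine mul_le_mul_of_nonneg_left ?_ (inv_nonneg.2 (Nat.cast_nonneg _))
        rw [gaugeLift_mul]
        exact norm_iteratedFDeriv_mul_le hF' hG' w hs'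
    _ ≤ tayNorm T r₀ F φ * tayNorm T r₀ G φ := sum_inv_factorial_choose_le ha hb r₀

/-- Product property for finite products (commutative values, `‖1‖ = 1`):
`‖∏_i F_i‖_{T_φ} ≤ ∏_i ‖F_i‖_{T_φ}`. [cite: AdamsBuchholzKoteckyMuller2019, Proposition 13.9] -/
theorem tayNorm_prod_le {ι : Type*} {𝔸' : Type*} [NormedCommRing 𝔸'] [NormedAlgebra ℝ 𝔸']
    [NormOneClass 𝔸'] (T : E →ₗ[ℝ] V) {r₀ : ℕ} (s : Finset ι) {F : ι → E → 𝔸'}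
    (hF : ∀ i ∈ s, ContDiff ℝ r₀ (F i)) (φ : E) :
    tayNorm T r₀ (fun ψ => ∏ i ∈ s, F i ψ) φ ≤ ∏ i ∈ s, tayNorm T r₀ (F i) φ := by
  classical
  induction s using Finset.induction_on with
  | empty =>
    simp only [Finset.prod_empty]
    rw [tayNorm_const, norm_one]
  | insert i s hi ih =>
    rw [Finset.prod_insert hi]
    have hFi : ContDiff ℝ r₀ (F i) := hF i (Finset.mem_insert_self i s)
    have hrest : ∀ j ∈ s, ContDiff ℝ r₀ (F j) := fun j hj => hF j (Finset.mem_insert_of_mem hj)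
    have hprod : ContDiff ℝ r₀ (fun ψ => ∏ j ∈ s, F j ψ) := contDiff_prod hrest
    have heq : (fun ψ => ∏ j ∈ insert i s, F j ψ) = F i * fun ψ => ∏ j ∈ s, F j ψ := by
      funext ψ
      rw [Finset.prod_insert hi]
      rfl
    rw [heq]
    refine (tayNorm_mul_le T hFi hprod φ).trans ?_
    exact mul_le_mul_of_nonneg_left (ih hrest) (tayNorm_nonneg _ _ _ _)

end Analytic
end Literature.MathematicalPhysics.StatisticalMechanics.GradientRG
end
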